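import Summits.ValiantsHypothesis.ValiantsHypothesis.Theorems.LacunarySymmetroidMatrixDescartesDoorA26WallBubblingThreeScaleTriple

/-!
# Wall bubbling for `DoorA26` — (W-split) structure, part B2: THE TWO- AND THREE-SCALE RUNGS IN CLUSTER CURRENCY (transport to arbitrary centres)

HONEST FRAMING.  Chain lemmas for obligation (W) `stub_weylFaces` of `Cruxes/DoorA26/Lines/wall_bubbling.lean` (stmt-ValiantsHypothesis-19979
`DoorA26`; OPEN, typed, never asserted), W2 seat val-sym-door-p1 g15; named residual «(W-split) multi-scale linking» of
`Cruxes/DoorA26/Lines/wall_bubbling_ConfluentDoor.lean` rev 4.  Pure TRANSPORT: the rungs #18 `twoScale_monotone`, #19 `twoScale_doubleton_split`,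
#20a `twoScale_triple_top`, #20b `twoScale_triple_mid`, #21 `threeScale_triple` are stated for letters recentred at the FIRST cluster and a shift
`L → +∞`; the cluster packages of part A (`…ConfluentClusters.confluentClusters`) present every cluster `c` at its own centre `s c k` (frames of the
letters `e^{δ_l s_c}U_l`, normalisations `μ_c`, limits `Γ_c`).  Recentring at `s c` and shifting by `L = s c' − s c` IS recentring at `s c'`
(`e^{δ L}·e^{δ s_c}U = e^{δ s_{c'}}U`), so for clusters `c < c'` (`s c' − s c → +∞`), resp. `c₁ < c₂ < c₃`:

* `clusters_monotone` — `Γ_c p q ≠ 0 → Γ_{c'} p' q' ≠ 0 → δ0 p + δ0 q ≤ δ0 p' + δ0 q'` (hmono of `chain_ceiling`);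
* `clusters_doubleton_split` — the confluent `t`-slot `(5,k)` (`k ∉ {0,5}`) is alive in at most one of `Γ_c, Γ_{c'}`;
* `clusters_triple_top` — `Γ_c 5 5 ≠ 0 → Γ_{c'} 5 5 = 0 ∧ Γ_{c'} 0 5 = 0`; `clusters_triple_mid` — `Γ_c 0 5 ≠ 0 → Γ_{c'} 5 5 = 0`;
* `clusters_triple_three` — `Γ_{c₁} 0 5, Γ_{c₂} 0 5, Γ_{c₃} 0 5` are not all alive.

Together these give the `hsplit` input of the count WITHOUT any mirrored (`t ↦ −t`) rung: a `t²`-slot alive at a LATER cluster with a confluent triple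
slot alive at an EARLIER one dies by `clusters_triple_top` (earlier degree 2) or `clusters_triple_mid` (earlier degree 1).  Part B3 `…TightChain` assembles.

No new definitions; nothing here bears on `DoorA26`, `MatrixDescartes` (stmt-ValiantsHypothesis-18050) or `VP ≠ VNP`; (W)/(W-split)/`ConfluentDoor26` OPEN.

[folklore] change of centre.  [this work] the bookkeeping.
-/

-- `Summit.ValiantsHypothesis.ValiantsHypothesis.…` repeats a component by the D-0017 layout
-- (single-conjunct summit), which the `dupNamespace` linter flags; the name is mandated.
set_option linter.dupNamespace false

namespace Summit.ValiantsHypothesis.ValiantsHypothesis.Theorems.LacunarySymmetroidMatrixDescartes.WallBubbling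

open Finset Filter Topology
open Bubbling (polar)
open scoped BigOperators

/-- Recentring at `s` and shifting by `s' − s` is recentring at `s'`. [folklore] -/
theorem recenter_shift (δ : Fin 6 → ℝ) (U : Fin 6 → Matrix (Fin 2) (Fin 2) ℝ) (s s' : ℝ) (l : Fin 6) :
    Real.exp (δ l * (s' - s)) • (Real.exp (δ l * s) • U l) = Real.exp (δ l * s') • U l := by
  rw [smul_smul, ← Real.exp_add]
  congr 1; ring

/-- Recentring at `s₁` and shifting by `(s₂ − s₁) + (s₃ − s₂)` is recentring at `s₃`. [folklore] -/
theorem recenter_shift_shift (δ : Fin 6 → ℝ) (U : Fin 6 → Matrix (Fin 2) (Fin 2) ℝ) (s₁ s₂ s₃ : ℝ) (l : Fin 6) :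
    Real.exp (δ l * ((s₂ - s₁) + (s₃ - s₂))) • (Real.exp (δ l * s₁) • U l) = Real.exp (δ l * s₃) • U l := by
  rw [smul_smul, ← Real.exp_add]
  congr 1; ring

/-- **TROPICAL MONOTONICITY BETWEEN TWO CLUSTERS** (#18 in cluster currency).  Clusters at centres `s c k`, `c < c'` drifting apart; Gram-normalised
confluent frames of the recentred letters converging at both (`hμ/hdom/hΓ` per cluster, as delivered by `confluentClusters`): an entry alive at `c` has
limit value at most that of any entry alive at `c'`. [this work] -/
theorem clusters_monotone (δs : ℕ → Fin 6 → ℝ) (δ0 : Fin 6 → ℝ)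
    (hδ : ∀ l, Tendsto (fun k => δs k l) atTop (𝓝 (δ0 l))) (h05 : δ0 5 = δ0 0)
    (U : ℕ → Fin 6 → Matrix (Fin 2) (Fin 2) ℝ) {C : ℕ} (s : Fin C → ℕ → ℝ)
    (μ : Fin C → ℕ → ℝ) (Γ : Fin C → Fin 6 → Fin 6 → ℝ) (hμ : ∀ c k, 0 < μ c k)
    (hdom : ∀ c k a b, |polar
      (if a = 0 then Real.exp (δs k 0 * s c k) • U k 0 + Real.exp (δs k 5 * s c k) • U k 5
        else if a = 5 then (δs k 5 - δs k 0) • (Real.exp (δs k 5 * s c k) • U k 5) else Real.exp (δs k a * s c k) • U k a)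
      (if b = 0 then Real.exp (δs k 0 * s c k) • U k 0 + Real.exp (δs k 5 * s c k) • U k 5
        else if b = 5 then (δs k 5 - δs k 0) • (Real.exp (δs k 5 * s c k) • U k 5) else Real.exp (δs k b * s c k) • U k b)| ≤ μ c k)
    (hΓ : ∀ c a b, Tendsto (fun k => polar
      (if a = 0 then Real.exp (δs k 0 * s c k) • U k 0 + Real.exp (δs k 5 * s c k) • U k 5
        else if a = 5 then (δs k 5 - δs k 0) • (Real.exp (δs k 5 * s c k) • U k 5) else Real.exp (δs k a * s c k) • U k a)
      (if b = 0 then Real.exp (δs k 0 * s c k) • U k 0 + Real.exp (δs k 5 * s c k) • U k 5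
        else if b = 5 then (δs k 5 - δs k 0) • (Real.exp (δs k 5 * s c k) • U k 5) else Real.exp (δs k b * s c k) • U k b) / μ c k)
      atTop (𝓝 (Γ c a b)))
    (c c' : Fin C) (hL : Tendsto (fun k => s c' k - s c k) atTop atTop)
    (p q p' q' : Fin 6) (hpq : Γ c p q ≠ 0) (hp'q' : Γ c' p' q' ≠ 0) :
    δ0 p + δ0 q ≤ δ0 p' + δ0 q' := by
  have hshift : ∀ k l, Real.exp (δs k l * (s c' k - s c k)) • (Real.exp (δs k l * s c k) • U k l)
      = Real.exp (δs k l * s c' k) • U k l := fun k l => recenter_shift (δs k) (U k) (s c k) (s c' k) l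
  refine twoScale_monotone δs δ0 hδ h05 (fun k l => Real.exp (δs k l * s c k) • U k l) (fun k => s c' k - s c k) hL
    (μ c) (μ c') (hμ c) (hμ c') (hdom c) ?_ (Γ c) (Γ c') (hΓ c) ?_ p q p' q' hpq hp'q'
  · intro k a b; simp only [hshift]; exact hdom c' k a b
  · intro a b; simp only [hshift]; exact hΓ c' a b

/-- **DOUBLETON SLOT SPLITTING BETWEEN TWO CLUSTERS** (#19 in cluster currency): the confluent `t`-slot `(5,k)`, `k ∉ {0,5}`, is alive in at most
one of two clusters. [this work] -/
theorem clusters_doubleton_split (δs : ℕ → Fin 6 → ℝ) (δ0 : Fin 6 → ℝ)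
    (hδ : ∀ l, Tendsto (fun k => δs k l) atTop (𝓝 (δ0 l))) (h05 : δ0 5 = δ0 0)
    (U : ℕ → Fin 6 → Matrix (Fin 2) (Fin 2) ℝ) {C : ℕ} (s : Fin C → ℕ → ℝ)
    (μ : Fin C → ℕ → ℝ) (Γ : Fin C → Fin 6 → Fin 6 → ℝ) (hμ : ∀ c k, 0 < μ c k)
    (hdom : ∀ c k a b, |polar
      (if a = 0 then Real.exp (δs k 0 * s c k) • U k 0 + Real.exp (δs k 5 * s c k) • U k 5
        else if a = 5 then (δs k 5 - δs k 0) • (Real.exp (δs k 5 * s c k) • U k 5) else Real.exp (δs k a * s c k) • U k a)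
      (if b = 0 then Real.exp (δs k 0 * s c k) • U k 0 + Real.exp (δs k 5 * s c k) • U k 5
        else if b = 5 then (δs k 5 - δs k 0) • (Real.exp (δs k 5 * s c k) • U k 5) else Real.exp (δs k b * s c k) • U k b)| ≤ μ c k)
    (hΓ : ∀ c a b, Tendsto (fun k => polar
      (if a = 0 then Real.exp (δs k 0 * s c k) • U k 0 + Real.exp (δs k 5 * s c k) • U k 5
        else if a = 5 then (δs k 5 - δs k 0) • (Real.exp (δs k 5 * s c k) • U k 5) else Real.exp (δs k a * s c k) • U k a)
      (if b = 0 then Real.exp (δs k 0 * s c k) • U k 0 + Real.exp (δs k 5 * s c k) • U k 5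
        else if b = 5 then (δs k 5 - δs k 0) • (Real.exp (δs k 5 * s c k) • U k 5) else Real.exp (δs k b * s c k) • U k b) / μ c k)
      atTop (𝓝 (Γ c a b)))
    (c c' : Fin C) (hL : Tendsto (fun k => s c' k - s c k) atTop atTop)
    (k : Fin 6) (hk0 : k ≠ 0) (hk5 : k ≠ 5) (h1 : Γ c 5 k ≠ 0) (h2 : Γ c' 5 k ≠ 0) : False := by
  have hshift : ∀ k l, Real.exp (δs k l * (s c' k - s c k)) • (Real.exp (δs k l * s c k) • U k l)
      = Real.exp (δs k l * s c' k) • U k l := fun k l => recenter_shift (δs k) (U k) (s c k) (s c' k) l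
  refine twoScale_doubleton_split δs δ0 hδ h05 (fun k l => Real.exp (δs k l * s c k) • U k l) (fun k => s c' k - s c k) hL
    (μ c) (μ c') (hμ c) (hμ c') (hdom c) ?_ (Γ c) (Γ c') (hΓ c) ?_ k hk0 hk5 h1 h2
  · intro k a b; simp only [hshift]; exact hdom c' k a b
  · intro a b; simp only [hshift]; exact hΓ c' a b

/-- **THE TRIPLE, TOP RULE BETWEEN TWO CLUSTERS** (#20a in cluster currency): the `t²`-slot alive at `c` kills both confluent triple slots at any
later cluster `c'`. [this work] -/
theorem clusters_triple_top (δs : ℕ → Fin 6 → ℝ) (δ0 : Fin 6 → ℝ)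
    (hδ : ∀ l, Tendsto (fun k => δs k l) atTop (𝓝 (δ0 l))) (h05 : δ0 5 = δ0 0)
    (U : ℕ → Fin 6 → Matrix (Fin 2) (Fin 2) ℝ) {C : ℕ} (s : Fin C → ℕ → ℝ)
    (μ : Fin C → ℕ → ℝ) (Γ : Fin C → Fin 6 → Fin 6 → ℝ) (hμ : ∀ c k, 0 < μ c k)
    (hdom : ∀ c k a b, |polar
      (if a = 0 then Real.exp (δs k 0 * s c k) • U k 0 + Real.exp (δs k 5 * s c k) • U k 5
        else if a = 5 then (δs k 5 - δs k 0) • (Real.exp (δs k 5 * s c k) • U k 5) else Real.exp (δs k a * s c k) • U k a)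
      (if b = 0 then Real.exp (δs k 0 * s c k) • U k 0 + Real.exp (δs k 5 * s c k) • U k 5
        else if b = 5 then (δs k 5 - δs k 0) • (Real.exp (δs k 5 * s c k) • U k 5) else Real.exp (δs k b * s c k) • U k b)| ≤ μ c k)
    (hΓ : ∀ c a b, Tendsto (fun k => polar
      (if a = 0 then Real.exp (δs k 0 * s c k) • U k 0 + Real.exp (δs k 5 * s c k) • U k 5
        else if a = 5 then (δs k 5 - δs k 0) • (Real.exp (δs k 5 * s c k) • U k 5) else Real.exp (δs k a * s c k) • U k a)
      (if b = 0 then Real.exp (δs k 0 * s c k) • U k 0 + Real.exp (δs k 5 * s c k) • U k 5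
        else if b = 5 then (δs k 5 - δs k 0) • (Real.exp (δs k 5 * s c k) • U k 5) else Real.exp (δs k b * s c k) • U k b) / μ c k)
      atTop (𝓝 (Γ c a b)))
    (c c' : Fin C) (hL : Tendsto (fun k => s c' k - s c k) atTop atTop)
    (h1 : Γ c 5 5 ≠ 0) : Γ c' 5 5 = 0 ∧ Γ c' 0 5 = 0 := by
  have hshift : ∀ k l, Real.exp (δs k l * (s c' k - s c k)) • (Real.exp (δs k l * s c k) • U k l)
      = Real.exp (δs k l * s c' k) • U k l := fun k l => recenter_shift (δs k) (U k) (s c k) (s c' k) l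
  refine twoScale_triple_top δs δ0 hδ h05 (fun k l => Real.exp (δs k l * s c k) • U k l) (fun k => s c' k - s c k) hL
    (μ c) (μ c') (hμ c) (hμ c') (hdom c) ?_ (Γ c) (Γ c') (hΓ c) ?_ h1
  · intro k a b; simp only [hshift]; exact hdom c' k a b
  · intro a b; simp only [hshift]; exact hΓ c' a b

/-- **THE TRIPLE, MIDDLE RULE BETWEEN TWO CLUSTERS** (#20b in cluster currency): the confluent `t`-slot `(0,5)` alive at `c` kills the `t²`-slot at any
later cluster `c'`. [this work] -/
theorem clusters_triple_mid (δs : ℕ → Fin 6 → ℝ) (δ0 : Fin 6 → ℝ)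
    (hδ : ∀ l, Tendsto (fun k => δs k l) atTop (𝓝 (δ0 l))) (h05 : δ0 5 = δ0 0)
    (U : ℕ → Fin 6 → Matrix (Fin 2) (Fin 2) ℝ) {C : ℕ} (s : Fin C → ℕ → ℝ)
    (μ : Fin C → ℕ → ℝ) (Γ : Fin C → Fin 6 → Fin 6 → ℝ) (hμ : ∀ c k, 0 < μ c k)
    (hdom : ∀ c k a b, |polar
      (if a = 0 then Real.exp (δs k 0 * s c k) • U k 0 + Real.exp (δs k 5 * s c k) • U k 5
        else if a = 5 then (δs k 5 - δs k 0) • (Real.exp (δs k 5 * s c k) • U k 5) else Real.exp (δs k a * s c k) • U k a)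
      (if b = 0 then Real.exp (δs k 0 * s c k) • U k 0 + Real.exp (δs k 5 * s c k) • U k 5
        else if b = 5 then (δs k 5 - δs k 0) • (Real.exp (δs k 5 * s c k) • U k 5) else Real.exp (δs k b * s c k) • U k b)| ≤ μ c k)
    (hΓ : ∀ c a b, Tendsto (fun k => polar
      (if a = 0 then Real.exp (δs k 0 * s c k) • U k 0 + Real.exp (δs k 5 * s c k) • U k 5
        else if a = 5 then (δs k 5 - δs k 0) • (Real.exp (δs k 5 * s c k) • U k 5) else Real.exp (δs k a * s c k) • U k a)
      (if b = 0 then Real.exp (δs k 0 * s c k) • U k 0 + Real.exp (δs k 5 * s c k) • U k 5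
        else if b = 5 then (δs k 5 - δs k 0) • (Real.exp (δs k 5 * s c k) • U k 5) else Real.exp (δs k b * s c k) • U k b) / μ c k)
      atTop (𝓝 (Γ c a b)))
    (c c' : Fin C) (hL : Tendsto (fun k => s c' k - s c k) atTop atTop)
    (h1 : Γ c 0 5 ≠ 0) : Γ c' 5 5 = 0 := by
  have hshift : ∀ k l, Real.exp (δs k l * (s c' k - s c k)) • (Real.exp (δs k l * s c k) • U k l)
      = Real.exp (δs k l * s c' k) • U k l := fun k l => recenter_shift (δs k) (U k) (s c k) (s c' k) l
  refine twoScale_triple_mid δs δ0 hδ h05 (fun k l => Real.exp (δs k l * s c k) • U k l) (fun k => s c' k - s c k) hL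
    (μ c) (μ c') (hμ c) (hμ c') (hdom c) ?_ (Γ c) (Γ c') (hΓ c) ?_ h1
  · intro k a b; simp only [hshift]; exact hdom c' k a b
  · intro a b; simp only [hshift]; exact hΓ c' a b

/-- **THE TRIPLE ACROSS THREE CLUSTERS** (#21 in cluster currency): the confluent `t`-slot `(0,5)` is alive in at most two of three clusters
`c₁ < c₂ < c₃`. [this work] -/
theorem clusters_triple_three (δs : ℕ → Fin 6 → ℝ) (δ0 : Fin 6 → ℝ)
    (hδ : ∀ l, Tendsto (fun k => δs k l) atTop (𝓝 (δ0 l))) (h05 : δ0 5 = δ0 0)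
    (U : ℕ → Fin 6 → Matrix (Fin 2) (Fin 2) ℝ) {C : ℕ} (s : Fin C → ℕ → ℝ)
    (μ : Fin C → ℕ → ℝ) (Γ : Fin C → Fin 6 → Fin 6 → ℝ) (hμ : ∀ c k, 0 < μ c k)
    (hdom : ∀ c k a b, |polar
      (if a = 0 then Real.exp (δs k 0 * s c k) • U k 0 + Real.exp (δs k 5 * s c k) • U k 5
        else if a = 5 then (δs k 5 - δs k 0) • (Real.exp (δs k 5 * s c k) • U k 5) else Real.exp (δs k a * s c k) • U k a)
      (if b = 0 then Real.exp (δs k 0 * s c k) • U k 0 + Real.exp (δs k 5 * s c k) • U k 5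
        else if b = 5 then (δs k 5 - δs k 0) • (Real.exp (δs k 5 * s c k) • U k 5) else Real.exp (δs k b * s c k) • U k b)| ≤ μ c k)
    (hΓ : ∀ c a b, Tendsto (fun k => polar
      (if a = 0 then Real.exp (δs k 0 * s c k) • U k 0 + Real.exp (δs k 5 * s c k) • U k 5
        else if a = 5 then (δs k 5 - δs k 0) • (Real.exp (δs k 5 * s c k) • U k 5) else Real.exp (δs k a * s c k) • U k a)
      (if b = 0 then Real.exp (δs k 0 * s c k) • U k 0 + Real.exp (δs k 5 * s c k) • U k 5
        else if b = 5 then (δs k 5 - δs k 0) • (Real.exp (δs k 5 * s c k) • U k 5) else Real.exp (δs k b * s c k) • U k b) / μ c k)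
      atTop (𝓝 (Γ c a b)))
    (c₁ c₂ c₃ : Fin C) (hL₁ : Tendsto (fun k => s c₂ k - s c₁ k) atTop atTop) (hL₂ : Tendsto (fun k => s c₃ k - s c₂ k) atTop atTop)
    (h1 : Γ c₁ 0 5 ≠ 0) (h2 : Γ c₂ 0 5 ≠ 0) (h3 : Γ c₃ 0 5 ≠ 0) : False := by
  have hshift : ∀ k l, Real.exp (δs k l * (s c₂ k - s c₁ k)) • (Real.exp (δs k l * s c₁ k) • U k l)
      = Real.exp (δs k l * s c₂ k) • U k l := fun k l => recenter_shift (δs k) (U k) (s c₁ k) (s c₂ k) l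
  have hshift' : ∀ k l, Real.exp (δs k l * ((s c₂ k - s c₁ k) + (s c₃ k - s c₂ k))) • (Real.exp (δs k l * s c₁ k) • U k l)
      = Real.exp (δs k l * s c₃ k) • U k l := fun k l => recenter_shift_shift (δs k) (U k) (s c₁ k) (s c₂ k) (s c₃ k) l
  refine threeScale_triple δs δ0 hδ h05 (fun k l => Real.exp (δs k l * s c₁ k) • U k l)
    (fun k => s c₂ k - s c₁ k) (fun k => s c₃ k - s c₂ k) hL₁ hL₂
    (μ c₁) (μ c₂) (μ c₃) (hμ c₁) (hμ c₂) (hμ c₃) (hdom c₁) ?_ ?_ (Γ c₁) (Γ c₂) (Γ c₃) (hΓ c₁) ?_ ?_ h1 h2 h3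
  · intro k a b; simp only [hshift]; exact hdom c₂ k a b
  · intro k a b; simp only [hshift']; exact hdom c₃ k a b
  · intro a b; simp only [hshift]; exact hΓ c₂ a b
  · intro a b; simp only [hshift']; exact hΓ c₃ a b

end Summit.ValiantsHypothesis.ValiantsHypothesis.Theorems.LacunarySymmetroidMatrixDescartes.WallBubbling
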